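import Literature.AlgebraicGeometry.Resolution.Lipman1969RationalSurfaceSingularities
import HarnessLib

/-!
# Intersection numbers under a proper birational map of regular surfaces: Lipman 1969, §15, p. 227,
# statements a) (proper transforms) and b) (contracted curves)

Topic: `Literature/AlgebraicGeometry/Resolution`. NAMED FACTS (D-0014), typed from the printed page of
J. Lipman, *Rational singularities, with applications to algebraic surfaces and unique factorization*,
Publ. Math. IHÉS 36 (1969) 195–279, §15 "Intrinsic nature of the sequence" (held copy
`paper:doi-10-1007-bf02684604`, PDF p. 34 = printed p. 227), in the vocabulary of
`Lipman1969RationalSurfaceSingularities` (`IsResolution`, `excCurvePoints`,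
`excCurveDegree f D η = (𝒪_X(D)·E_η)` = Lipman's `(D·E)` for the integral curve `E = E_η`) and of
`Motives/CartierDivisor` (`CartierDivisor.pullback g` = the total transform `g^*(D)` along a dominant
morphism of integral schemes, Görtz–Wedhorn I, Def. 11.49).

## The source (p. 227; standing setting of §14–§15: `R` a two-dimensional normal local ring with a
## desingularization `f : X → Spec(R)`, p. 224)

"To this end, let `g : X' → X` be a proper birational map with `X'` regular. For any divisor `D` on `X`
there is a unique divisor `D' = g^*(D)` on `X'` with the property that for any `x' ∈ X'`, a local equation
for `D` at `g(x')` is also a local equation for `D'` at `x'`; moreover we have a canonical isomorphism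
`g^*(𝒪_X(D)) ≅ 𝒪_{X'}(D')`. `D'` can be represented uniquely in the form `D' = D^♯ + F'` where `D^♯` is a
formal linear combination of prime divisors whose supports are mapped by `g` onto curves on `X`, while the
support of `F'` is mapped into a zero-dimensional subset of `X`. `D^♯` is the proper transform of `D` (by
`g`). It is an easy consequence of Proposition (10.2) b) that:
a) if `G` is an exceptional curve on `X` then `(D'·G^♯) = (D'·G') = (D·G)`;
b) if `F` is any curve on `X'` such that `g(F)` is zero-dimensional, then `F` has exceptional support, and
`(D'·F) = 0`."

## What is vendored, and in which vocabulary

Setting: `R` a Noetherian local domain of Krull dimension `2`, integrally closed (normal); a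
desingularization `f : X → Spec R` (`IsResolution`, `X` integral); a second integral regular `X'` with
`g : X' → X` proper, birational and dominant (so that the total transform `g^*D = D.pullback g` of a Cartier
divisor is defined, `Motives/CartierDivisor`); intersection numbers on `X'` are taken relative to
`g ≫ f : X' → Spec R`.

* `Lipman1969_15_a` — a), in the form `(D'·G^♯) = (D·G)` for an INTEGRAL exceptional curve `G = E_η`,
  `η ∈ excCurvePoints f`: for every point `η' ∈ X'` over `η` whose closure is a curve (`Order.height η' = 1`;
  `E_{η'}` is then the proper transform `G^♯`, the prime divisor of `X'` mapped onto `G`),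
  `excCurveDegree (g ≫ f) (D.pullback g) η' = excCurveDegree f D η`. (The middle term `(D'·G')`, the
  intersection with the non-integral total transform `G'`, is not typed.)
* `Lipman1969_15_b` — b) for an INTEGRAL curve `F = E_ζ` on `X'` (`Order.height ζ = 1`) contracted by `g`
  to a closed point (`g(F)` zero-dimensional): `F` has exceptional support relative to `g ≫ f`
  (`ζ ∈ excCurvePoints (g ≫ f)`) and `(D'·F) = excCurveDegree (g ≫ f) (D.pullback g) ζ = 0` for every
  Cartier divisor `D` on `X`.

VACUITY: the hypothesis blocks are satisfiable (e.g. `g` the blow-up of a closed point of `X`, `F` its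
exceptional line, `G` any exceptional curve of `f`), and neither `Prop` is decided by unfolding.

## What is NOT here

The proofs; the existence/uniqueness of `D'` and of the decomposition `D' = D^♯ + F'` (in the tree,
`D' = D.pullback g` is a construction); the equality `(D'·G') = (D·G)` with the non-integral total
transform `G'`; a), b) for non-integral curves `G`, `F`; the rest of §15 (Lemma (15.2), Theorem (15.3)).
`-- TODO(general form)` lines record the printed generality. Consumers: the crux chain W4.4 of the
summit `ResolutionOfSingularities` (transport of intersection numbers along point blow-ups of a
resolution); nothing here depends on that summit.

## References

* J. Lipman, *Rational singularities, with applications to algebraic surfaces and unique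
  factorization*, Publ. Math. IHÉS 36 (1969) 195–279: §15, p. 227, a) and b); §14 p. 224 (standing
  setting); Prop. (10.2) b) p. 214. [Lipman1969]
* U. Görtz, T. Wedhorn, *Algebraic Geometry I* (2nd ed., 2020), Def. 11.49, Prop. 11.50 (pull-back of
  Cartier divisors). [GortzWedhorn2020]
-/

noncomputable section

open CategoryTheory AlgebraicGeometry TopologicalSpace IsLocalRing
open Literature.AlgebraicGeometry.Motives

universe u

namespace Literature.AlgebraicGeometry.Resolution

/-! ## §15 a): intersection numbers with proper transforms of exceptional curves -/

/-- NAMED FACT — **Lipman 1969, §15 (p. 227), statement a)**: for `g : X' → X` proper birational with `X'`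
regular (`X` a desingularization of the two-dimensional normal local `R`), `D` a divisor on `X` with total
transform `D' = g^*(D)`, "a) if `G` is an exceptional curve on `X` then `(D'·G^♯) = (D'·G') = (D·G)`"
(`G^♯` the proper transform). Rendered for an INTEGRAL exceptional curve `G = E_η`, `η ∈ excCurvePoints f`
(`f : X → Spec R` the desingularization, `R` a normal Noetherian local domain of dimension `2`), `X`, `X'`
integral, `X'` regular, `g` proper birational and dominant, `D : CartierDivisor X` with total transform
`D.pullback g`, and the proper transform `G^♯ = E_{η'}` for any `η' ∈ X'` over `η` with one-dimensional
closure: `(D'·G^♯) = excCurveDegree (g ≫ f) (D.pullback g) η' = excCurveDegree f D η = (D·G)`. The middle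
equality `(D'·G')` (total transform of `G`) is not typed. Users take `(h : Lipman1969_15_a)`.
[cite: Lipman1969, Section 15, statement a) (p. 227)] -/
def Lipman1969_15_a : Prop :=
  ∀ (R : Type u) [CommRing R] [IsNoetherianRing R] [IsLocalRing R] [IsDomain R]
    [IsIntegrallyClosed R], ringKrullDim R = 2 →
    ∀ (X : Scheme.{u}) [IsIntegral X] [IsLocallyNoetherian X] (f : X ⟶ Spec (.of R)),
      IsResolution f →
    ∀ (X' : Scheme.{u}) [IsIntegral X'] [IsLocallyNoetherian X'] (g : X' ⟶ X) [IsDominant g],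
      IsProper g → IsBirational g → Scheme.IsRegular X' →
    ∀ (D : CartierDivisor X), ∀ η ∈ excCurvePoints f, ∀ (η' : X'),
      g.base η' = η → Order.height η' = 1 →
        excCurveDegree (g ≫ f) (D.pullback g) η' = excCurveDegree f D η
-- TODO(general form): Lipman's a) also asserts `(D'·G') = (D·G)` for the (non-integral) total
-- transform `G'` of `G`, and allows any exceptional curve `G` (effective divisor with exceptional support).

/-! ## §15 b): curves contracted by `g` -/

/-- NAMED FACT — **Lipman 1969, §15 (p. 227), statement b)**: for `g : X' → X` proper birational with `X'`
regular (`X` a desingularization of the two-dimensional normal local `R`) and `D' = g^*(D)` the total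
transform of a divisor `D` on `X`, "b) if `F` is any curve on `X'` such that `g(F)` is zero-dimensional,
then `F` has exceptional support, and `(D'·F) = 0`." Rendered for an INTEGRAL curve `F = E_ζ` on `X'`
(`ζ ∈ X'` with one-dimensional closure, `Order.height ζ = 1`) whose image point `g(ζ)` is a closed point of
`X` (so `g(F) = {g(ζ)}` is zero-dimensional), with `R`, `f`, `X`, `X'`, `g`, `D` as in `Lipman1969_15_a`:
`F` has exceptional support relative to `g ≫ f` (`ζ ∈ excCurvePoints (g ≫ f)`: over the closed point of
`Spec R`, one-dimensional closure) and `(D'·F) = excCurveDegree (g ≫ f) (D.pullback g) ζ = 0`. Users take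
`(h : Lipman1969_15_b)`. [cite: Lipman1969, Section 15, statement b) (p. 227)] -/
def Lipman1969_15_b : Prop :=
  ∀ (R : Type u) [CommRing R] [IsNoetherianRing R] [IsLocalRing R] [IsDomain R]
    [IsIntegrallyClosed R], ringKrullDim R = 2 →
    ∀ (X : Scheme.{u}) [IsIntegral X] [IsLocallyNoetherian X] (f : X ⟶ Spec (.of R)),
      IsResolution f →
    ∀ (X' : Scheme.{u}) [IsIntegral X'] [IsLocallyNoetherian X'] (g : X' ⟶ X) [IsDominant g],
      IsProper g → IsBirational g → Scheme.IsRegular X' →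
    ∀ (D : CartierDivisor X) (ζ : X'), Order.height ζ = 1 → IsClosed ({g.base ζ} : Set X) →
      ζ ∈ excCurvePoints (g ≫ f) ∧ excCurveDegree (g ≫ f) (D.pullback g) ζ = 0
-- TODO(general form): Lipman's b) allows any curve `F` on `X'` (effective divisor with one-dimensional
-- support) with `g(F)` zero-dimensional, not only integral ones.

end Literature.AlgebraicGeometry.Resolution

end
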